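import Literature.IUT.LogVolume.PilotDivisors
import Literature.IUT.LogVolume.PrincipalArithmeticDivisors
import Literature.IUT.LogVolume.RArithmeticDivisorsBridge
import HarnessLib

/-!
# Dupuy–Hilado pilot data under a finite extension `K/F`: the pilot divisors PULL BACK and their normalised
# degrees `deĝ̲(P_q)`, `deĝ̲(P_{Θ,j})`, `deĝ̲_lgp(P_Θ)` are INDEPENDENT OF THE FIELD — PROVED

Dupuy–Hilado, *The statement of Mochizuki's Corollary 3.12*, arXiv:2004.13228, §2.5.4 (read on the page): "If
`L ⊂ L'` is a field extension … then `deĝ̲_{L'}(φ^*D) = deĝ̲_L(D)`" (the normalisation `deĝ̲ = deĝ/[L:ℚ]` makes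
degrees base-change invariant); §3.3: the pilot data `(F, j_E, S, l)`, `P_q := Σ_{v∈S} ord_v(q̲_v)[v]`,
`q̲_v = q_v^{1/2l}`, `P_{Θ,j} = Σ_{v∈S} ord_v(q̲_v^{j²})[v]`. Mochizuki, *Inter-universal Teichmüller theory IV*,
Thm. 1.10, kurims p. 23 l. 61–62: "the various `log(q_{(−)})`'s are independent of the choice of `F□`"; Def. 1.9 (i)
p. 22: "`deg(𝔞|_K) = deg(𝔞)`". [GenEll] Rmk. 3.3.1 / [IUTchIV] p. 45 (P2): over an extension the orders of the
`q`-parameters get multiplied by the ramification indices.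

PROOF-ONLY file (classical valuation theory; NO definition, NO new `Prop`; TAKES NO SIDE on [IUTchIII]
Cor. 3.12 — no Θ-link, no log-volume occurs). It is the `PilotData` twin (abc-iut-c312-3's
`Literature.IUT.LogVolume.PilotData`, `PilotDivisors.lean`) of abc-iut's `Corollary22QParamBaseChange.lean`
(the same statement for the `λ`-line presentations `Cor22.qDivisor`), written for the cell abc-iut's repair
R1 of the «genuine-setting» certificates (a `K`-LEVEL pilot datum `(K, j_E, S_K, l)` OVER an `F`-level one,
`K = F(E_F[l])` in [IUTchI] Def. 3.1 (c); consumer abc-iut-C-cert-3's `Cor312ProvK.lean`): everything the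
`q`-side of that repair needs from algebraic number theory, by name.

TWO pilot data `X` over `F` and `Y` over a finite extension `K ⊇ F` are compared through three hypotheses
(no structure, so that ANY construction of the `K`-level datum can be plugged in):
`hS : ∀ w, w ∈ Y.S ↔ finBelow F K w ∈ X.S` ("`S_K` = the primes of `K` over `S`"),
`hord : ∀ w ∈ Y.S, ord_w(q) = e(w|v)·ord_v(q)` (automatic when `j_{E,K} = j_{E,F}` viewed in `K`:
`ordq_eq_of_jE_eq`), `hl : Y.l = X.l`. Results:

* §1 (building blocks for the `K`-level datum, def-free): `ord_algebraMap_jE` (`ord_w(j_E) = e(w|v)·ord_v(j_E)`,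
  the tree's `ord_algebraMap` = Mathlib `valuation_liesOver`), `ord_algebraMap_jE_neg` (a prime over a bad prime
  is bad), `mem_biUnion_primesOverFinset_iff` (the finset `⋃_{v∈S}` {primes of `𝓞_K` in the factorisation of
  `v𝓞_K`} is exactly `{w : v(w) ∈ S}`), `exists_finBelow_eq` / `biUnion_primesOverFinset_nonempty` (going up:
  it is non-empty when `S` is);
* §2 (coefficients): `qPilot_apply`, `thetaPilot_apply`, `ordq_eq_of_jE_eq`, `lstar_eq_of_l_eq`;
* §3 (pull-back): **`ofFinDivisor_qPilot_eq_pullback`** — `P_q(Y) = P_q(X)|_K` as `ℝ`-arithmetic divisors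
  ([IUTchIV] Def. 1.9 (i): `𝔞|_K = Σ_w e_{w|v}·c_{v(w)}·w`), and the same for `𝔮` and `P_{Θ,j}`;
* §4 (invariance): **`ndeg_qPilot_eq`** `deĝ̲_K(P_q(Y)) = deĝ̲_F(P_q(X))`, `ndeg_qDivisor_eq`,
  `ndeg_thetaPilot_eq`, **`ndegLgp_thetaPilot_eq`** `deĝ̲_lgp(P_Θ(Y)) = deĝ̲_lgp(P_Θ(X))` — by the tree's
  `ndeg_pullback` (Mathlib's fundamental identity `Σ_{w|v} e_{w|v} f_{w|v} = [K:F]`,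
  `sum_pullbackWeight_mul_degWeight_inr`, and `[K:ℚ] = [K:F]·[F:ℚ]`); the `_of_jE_eq` forms take
  `Y.jE = algebraMap F K X.jE` instead of `hord`.

[cite: DupuyHilado2025, §2.5.4, §3.3] [cite: Mochizuki2012, IUTchIV Def. 1.9 (i) p. 22; Thm. 1.10 p. 23]
[cite: SerreLocalFields1979, Ch. I §4] for `ord_w = e·ord_v`. IUT locators carry [claim: Mochizuki2012, status:
disputed] as a bibliographic status only; the mathematics here is classical and undisputed.
-/

noncomputable section

namespace Literature.IUT.LogVolume

namespace PilotData

open NumberField IsDedekindDomain Finset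
open scoped Classical

variable {F K : Type*} [Field F] [NumberField F] [Field K] [NumberField K] [Algebra F K]

/-! ## §1. Valuations and primes along `F ⊆ K` (building blocks for a `K`-level pilot datum) -/

/-- `ord_w(j_E) = e(w|v)·ord_v(j_E)` for a prime `w` of `K` over the prime `v = w ∩ 𝓞_F` of `F` (the tree's
`ord_algebraMap`; Mathlib `valuation_liesOver`). [cite: SerreLocalFields1979, Ch. I §4] -/
theorem ord_algebraMap_jE (X : PilotData F) (w : HeightOneSpectrum (𝓞 K)) :
    ord K w (algebraMap F K X.jE) =
      (Ideal.ramificationIdx' (finBelow F K w).asIdeal w.asIdeal : ℤ) * ord F (finBelow F K w) X.jE := by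
  rw [ord_algebraMap]

omit [NumberField F] in
/-- `e(w|v) ≥ 1` for a prime `w` of `𝓞_K` over the prime `v` of `𝓞_F` under it (Mathlib).
[cite: SerreLocalFields1979, Ch. I §4] -/
theorem ramificationIdx'_finBelow_pos (w : HeightOneSpectrum (𝓞 K)) :
    0 < Ideal.ramificationIdx' (finBelow F K w).asIdeal w.asIdeal :=
  Nat.pos_of_ne_zero
    (Ideal.IsDedekindDomain.ramificationIdx'_ne_zero_of_liesOver w.asIdeal (finBelow F K w).ne_bot)

/-- **A prime of `K` over a bad prime of the pilot data is bad**: `ord_w(j_E) < 0` whenever `v(w) ∈ S`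
(`ord_w = e(w|v)·ord_v` with `e(w|v) ≥ 1`). This is the field `ord_jE_neg` of a `K`-level pilot datum with
`j_E` viewed in `K` and `S_K` = the primes over `S`. [cite: DupuyHilado2025, §3.3] -/
theorem ord_algebraMap_jE_neg (X : PilotData F) {w : HeightOneSpectrum (𝓞 K)} (hw : finBelow F K w ∈ X.S) :
    ord K w (algebraMap F K X.jE) < 0 := by
  rw [ord_algebraMap_jE]
  have he : (0 : ℤ) < Ideal.ramificationIdx' (finBelow F K w).asIdeal w.asIdeal := by
    exact_mod_cast ramificationIdx'_finBelow_pos (F := F) w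
  exact mul_neg_of_pos_of_neg he (X.ord_jE_neg _ hw)

/-- The sign of `ord(j_E)` is the same above and below: `ord_w(j_E) < 0 ↔ ord_{v(w)}(j_E) < 0`.
[cite: DupuyHilado2025, §3.3] -/
theorem ord_algebraMap_jE_neg_iff (X : PilotData F) (w : HeightOneSpectrum (𝓞 K)) :
    ord K w (algebraMap F K X.jE) < 0 ↔ ord F (finBelow F K w) X.jE < 0 := by
  rw [ord_algebraMap_jE]
  have he : (0 : ℤ) < Ideal.ramificationIdx' (finBelow F K w).asIdeal w.asIdeal := by
    exact_mod_cast ramificationIdx'_finBelow_pos (F := F) w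
  constructor
  · intro h
    by_contra hge
    exact absurd h (not_lt.mpr (mul_nonneg he.le (not_lt.mp hge)))
  · intro h
    exact mul_neg_of_pos_of_neg he h

/-- **The primes of `K` over a finite set `S` of primes of `F`, as a finset** (def-free: the union over `v ∈ S`
of the prime factors of `v·𝓞_K`, Mathlib's `primesOverFinset`, read in `HeightOneSpectrum (𝓞 K)`): a prime `w`
belongs to it iff the prime `v(w) = w ∩ 𝓞_F` under it lies in `S`. [cite: Mochizuki2012, IUTchIV Def. 1.9 (ii) p. 22] -/
theorem mem_biUnion_primesOverFinset_iff (S : Finset (HeightOneSpectrum (𝓞 F))) (w : HeightOneSpectrum (𝓞 K)) :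
    w ∈ S.biUnion (fun v => (IsDedekindDomain.primesOverFinset v.asIdeal (𝓞 K)).preimage
        HeightOneSpectrum.asIdeal (fun _ _ _ _ h => HeightOneSpectrum.ext h)) ↔ finBelow F K w ∈ S := by
  constructor
  · intro h
    obtain ⟨v, hv, hw⟩ := Finset.mem_biUnion.mp h
    rwa [finBelow_eq_of_mem hw]
  · intro h
    refine Finset.mem_biUnion.mpr ⟨finBelow F K w, h, ?_⟩
    haveI : (finBelow F K w).asIdeal.IsMaximal := (finBelow F K w).isMaximal
    rw [Finset.mem_preimage, IsDedekindDomain.mem_primesOverFinset_iff (finBelow F K w).ne_bot]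
    exact ⟨w.isPrime, liesOver_finBelow (F := F) (K := K) w⟩

omit [NumberField K] in
/-- **Going up**: over every prime `v` of `F` there is a prime `w` of `K` (`𝓞_K` is integral over `𝓞_F`; Mathlib
`Ideal.exists_maximal_ideal_liesOver_of_isIntegral`). [cite: SerreLocalFields1979, Ch. I §4] -/
theorem exists_finBelow_eq (v : HeightOneSpectrum (𝓞 F)) : ∃ w : HeightOneSpectrum (𝓞 K), finBelow F K w = v := by
  haveI := v.isPrime.isMaximal v.ne_bot
  obtain ⟨P, hPmax, hP⟩ := Ideal.exists_maximal_ideal_liesOver_of_isIntegral (S := 𝓞 K) v.asIdeal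
  exact ⟨⟨P, hPmax.isPrime, Ideal.ne_bot_of_liesOver_of_ne_bot v.ne_bot P⟩, HeightOneSpectrum.ext hP.over.symm⟩

/-- The primes over a NON-EMPTY finite set of primes form a non-empty finset (the field `S_nonempty` of a
`K`-level pilot datum). [cite: DupuyHilado2025, §3.3] -/
theorem biUnion_primesOverFinset_nonempty {S : Finset (HeightOneSpectrum (𝓞 F))} (hS : S.Nonempty) :
    (S.biUnion (fun v => (IsDedekindDomain.primesOverFinset v.asIdeal (𝓞 K)).preimage
        HeightOneSpectrum.asIdeal (fun _ _ _ _ h => HeightOneSpectrum.ext h))).Nonempty := by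
  obtain ⟨v, hv⟩ := hS
  obtain ⟨w, hw⟩ := exists_finBelow_eq (K := K) v
  exact ⟨w, (mem_biUnion_primesOverFinset_iff S w).mpr (by rwa [hw])⟩

/-! ## §2. Coefficients of the pilot divisors; `ord(q)` and `ℓ⋇` along the comparison -/

/-- Coefficients of `P_q`: `ord_v(q_v)/(2l)` at `v ∈ S`, `0` elsewhere. [cite: DupuyHilado2025, §3.3] -/
theorem qPilot_apply (X : PilotData F) (v : HeightOneSpectrum (𝓞 F)) :
    X.qPilot v = if v ∈ X.S then (X.ordq v : ℝ) / (2 * X.l) else 0 := by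
  unfold qPilot
  rw [Finset.sum_apply']
  simp only [FinDivisor.of, Finsupp.single_apply]
  rw [Finset.sum_ite_eq']

/-- Coefficients of `𝔮 = Σ_{v∈S} ord_v(q_v)[v]`: `ord_v(q_v)` at `v ∈ S`, `0` elsewhere. [cite: DupuyHilado2025, §3.3] -/
theorem qDivisor_apply (X : PilotData F) (v : HeightOneSpectrum (𝓞 F)) :
    X.qDivisor v = if v ∈ X.S then (X.ordq v : ℝ) else 0 := by
  unfold qDivisor
  rw [Finset.sum_apply']
  simp only [FinDivisor.of, Finsupp.single_apply]
  rw [Finset.sum_ite_eq']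

/-- Coefficients of `P_{Θ,j}`: `j²·ord_v(q_v)/(2l)` at `v ∈ S`, `0` elsewhere (`i : Fin ℓ⋇` stands for `j = i+1`).
[cite: DupuyHilado2025, §3.3] -/
theorem thetaPilot_apply (X : PilotData F) (i : Fin X.lstar) (v : HeightOneSpectrum (𝓞 F)) :
    X.thetaPilot i v = if v ∈ X.S then (((i : ℕ) + 1 : ℝ) ^ 2) * (X.ordq v : ℝ) / (2 * X.l) else 0 := by
  unfold thetaPilot
  rw [Finset.sum_apply']
  simp only [FinDivisor.of, Finsupp.single_apply]
  rw [Finset.sum_ite_eq']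

/-- **`ord_w(q_w) = e(w|v)·ord_v(q_v)`** when the `K`-level datum has the same `j`-invariant (`j_{E,K} = j_{E,F}`
viewed in `K`): the orders of the Tate parameters over an extension are multiplied by the ramification indices
([GenEll] Rmk. 3.3.1; [IUTchIV] p. 45 (P2)); with `ord_v(q_v) := −ord_v(j_E)` (the tree's modelling choice in
`PilotDivisors.lean`) this is `ord_algebraMap`. [cite: DupuyHilado2025, §3.2–3.3] -/
theorem ordq_eq_of_jE_eq (X : PilotData F) (Y : PilotData K) (hj : Y.jE = algebraMap F K X.jE)
    (w : HeightOneSpectrum (𝓞 K)) :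
    Y.ordq w = (Ideal.ramificationIdx' (finBelow F K w).asIdeal w.asIdeal : ℤ) * X.ordq (finBelow F K w) := by
  unfold ordq
  rw [hj, ord_algebraMap_jE]
  ring

omit [Algebra F K] in
/-- Same `l`, same `ℓ⋇ = (l−1)/2`. [cite: DupuyHilado2025, §3.3] -/
theorem lstar_eq_of_l_eq (X : PilotData F) (Y : PilotData K) (hl : Y.l = X.l) : Y.lstar = X.lstar := by
  unfold lstar
  rw [hl]

/-! ## §3. The pilot divisors of the `K`-level datum are the pull-backs of those of the `F`-level datum -/

section Compare

variable (X : PilotData F) (Y : PilotData K)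
  (hS : ∀ w : HeightOneSpectrum (𝓞 K), w ∈ Y.S ↔ finBelow F K w ∈ X.S)
  (hord : ∀ w ∈ Y.S,
    Y.ordq w = (Ideal.ramificationIdx' (finBelow F K w).asIdeal w.asIdeal : ℤ) * X.ordq (finBelow F K w))

include hS hord

/-- **`𝔮(Y) = 𝔮(X)|_K`** as `ℝ`-arithmetic divisors of `K` ([IUTchIV] Def. 1.9 (i): `𝔞|_K = Σ_w e_{w|v}·c_{v(w)}·w`):
coefficientwise `ord_w(q) = e(w|v)·ord_v(q)` on `S_K = {w : v(w) ∈ S}`, `0 = e·0` elsewhere, and nothing at the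
archimedean places. [cite: Mochizuki2012, IUTchIV Def. 1.9 (i) p. 22] -/
theorem ofFinDivisor_qDivisor_eq_pullback :
    ADivisor.ofFinDivisor K Y.qDivisor = (ADivisor.ofFinDivisor F X.qDivisor).pullback F K := by
  ext w
  rcases w with w | w
  · rw [ADivisor.ofFinDivisor_apply_inl, ADivisor.pullback_apply]
    change (0 : ℝ) = _ * ADivisor.ofFinDivisor F X.qDivisor (Sum.inl (w.comap (algebraMap F K)))
    rw [ADivisor.ofFinDivisor_apply_inl, mul_zero]
  · rw [ADivisor.pullback_apply]
    change ADivisor.ofFinDivisor K Y.qDivisor (Sum.inr w) =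
      _ * ADivisor.ofFinDivisor F X.qDivisor (Sum.inr (finBelow F K w))
    rw [ADivisor.ofFinDivisor_apply_inr, ADivisor.ofFinDivisor_apply_inr, qDivisor_apply, qDivisor_apply]
    have he : (pullbackWeight F K (Sum.inr w) : ℝ) =
        (Ideal.ramificationIdx' (finBelow F K w).asIdeal w.asIdeal : ℝ) := rfl
    by_cases hw : w ∈ Y.S
    · rw [if_pos hw, if_pos ((hS w).mp hw), hord w hw, he]
      push_cast
      ring
    · have hv : finBelow F K w ∉ X.S := fun h => hw ((hS w).mpr h)
      rw [if_neg hw, if_neg hv, mul_zero]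

/-- **`P_q(Y) = P_q(X)|_K`** (same computation with the common factor `1/(2l)`, `hl : Y.l = X.l`).
[cite: Mochizuki2012, IUTchIV Def. 1.9 (i) p. 22] [cite: DupuyHilado2025, §3.3] -/
theorem ofFinDivisor_qPilot_eq_pullback (hl : Y.l = X.l) :
    ADivisor.ofFinDivisor K Y.qPilot = (ADivisor.ofFinDivisor F X.qPilot).pullback F K := by
  ext w
  rcases w with w | w
  · rw [ADivisor.ofFinDivisor_apply_inl, ADivisor.pullback_apply]
    change (0 : ℝ) = _ * ADivisor.ofFinDivisor F X.qPilot (Sum.inl (w.comap (algebraMap F K)))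
    rw [ADivisor.ofFinDivisor_apply_inl, mul_zero]
  · rw [ADivisor.pullback_apply]
    change ADivisor.ofFinDivisor K Y.qPilot (Sum.inr w) =
      _ * ADivisor.ofFinDivisor F X.qPilot (Sum.inr (finBelow F K w))
    rw [ADivisor.ofFinDivisor_apply_inr, ADivisor.ofFinDivisor_apply_inr, qPilot_apply, qPilot_apply]
    have he : (pullbackWeight F K (Sum.inr w) : ℝ) =
        (Ideal.ramificationIdx' (finBelow F K w).asIdeal w.asIdeal : ℝ) := rfl
    by_cases hw : w ∈ Y.S
    · rw [if_pos hw, if_pos ((hS w).mp hw), hord w hw, he, hl]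
      push_cast
      ring
    · have hv : finBelow F K w ∉ X.S := fun h => hw ((hS w).mpr h)
      rw [if_neg hw, if_neg hv, mul_zero]

/-- **`P_{Θ,j}(Y) = P_{Θ,j}(X)|_K`** for every label `j` (indices `i : Fin ℓ⋇(Y)`, `i' : Fin ℓ⋇(X)` with the same
value; `ℓ⋇(Y) = ℓ⋇(X)` by `lstar_eq_of_l_eq`). [cite: Mochizuki2012, IUTchIV Def. 1.9 (i) p. 22] [cite: DupuyHilado2025, §3.3] -/
theorem ofFinDivisor_thetaPilot_eq_pullback (hl : Y.l = X.l) (i : Fin Y.lstar) (i' : Fin X.lstar)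
    (hii' : (i : ℕ) = i') :
    ADivisor.ofFinDivisor K (Y.thetaPilot i) = (ADivisor.ofFinDivisor F (X.thetaPilot i')).pullback F K := by
  ext w
  rcases w with w | w
  · rw [ADivisor.ofFinDivisor_apply_inl, ADivisor.pullback_apply]
    change (0 : ℝ) = _ * ADivisor.ofFinDivisor F (X.thetaPilot i') (Sum.inl (w.comap (algebraMap F K)))
    rw [ADivisor.ofFinDivisor_apply_inl, mul_zero]
  · rw [ADivisor.pullback_apply]
    change ADivisor.ofFinDivisor K (Y.thetaPilot i) (Sum.inr w) =
      _ * ADivisor.ofFinDivisor F (X.thetaPilot i') (Sum.inr (finBelow F K w))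
    rw [ADivisor.ofFinDivisor_apply_inr, ADivisor.ofFinDivisor_apply_inr, thetaPilot_apply, thetaPilot_apply]
    have he : (pullbackWeight F K (Sum.inr w) : ℝ) =
        (Ideal.ramificationIdx' (finBelow F K w).asIdeal w.asIdeal : ℝ) := rfl
    by_cases hw : w ∈ Y.S
    · rw [if_pos hw, if_pos ((hS w).mp hw), hord w hw, he, hl, hii']
      push_cast
      ring
    · have hv : finBelow F K w ∉ X.S := fun h => hw ((hS w).mpr h)
      rw [if_neg hw, if_neg hv, mul_zero]

/-! ## §4. Independence of the field: the normalised degrees agree -/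

/-- **`deĝ̲_K(𝔮(Y)) = deĝ̲_F(𝔮(X))`** — "the various `log(q_{(−)})`'s are independent of the choice of `F□`"
([IUTchIV] Thm. 1.10 p. 23) for Dupuy–Hilado pilot data: pull back and use `deg(𝔞|_K) = deg(𝔞)` (Def. 1.9 (i), the
tree's `ndeg_pullback`). [cite: Mochizuki2012, IUTchIV Thm. 1.10 p. 23] [cite: DupuyHilado2025, §2.5.4] -/
theorem ndeg_qDivisor_eq : FinDivisor.ndeg K Y.qDivisor = FinDivisor.ndeg F X.qDivisor := by
  rw [← ndeg_ofFinDivisor, ← ndeg_ofFinDivisor, ofFinDivisor_qDivisor_eq_pullback X Y hS hord, ndeg_pullback]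

/-- **`deĝ̲_K(P_q(Y)) = deĝ̲_F(P_q(X))`**: the `q`-pilot degree `|log(q)| = (1/2l)·log(q)` does not depend on the
field carrying the pilot data. [cite: Mochizuki2012, IUTchIV Thm. 1.10 p. 23] [cite: DupuyHilado2025, §2.5.4, §3.3] -/
theorem ndeg_qPilot_eq (hl : Y.l = X.l) : FinDivisor.ndeg K Y.qPilot = FinDivisor.ndeg F X.qPilot := by
  rw [← ndeg_ofFinDivisor, ← ndeg_ofFinDivisor, ofFinDivisor_qPilot_eq_pullback X Y hS hord hl, ndeg_pullback]

/-- **`deĝ̲_K(P_{Θ,j}(Y)) = deĝ̲_F(P_{Θ,j}(X))`** for every label `j`.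
[cite: Mochizuki2012, IUTchIV Def. 1.9 (i) p. 22] [cite: DupuyHilado2025, §2.5.4, §3.3] -/
theorem ndeg_thetaPilot_eq (hl : Y.l = X.l) (i : Fin Y.lstar) (i' : Fin X.lstar) (hii' : (i : ℕ) = i') :
    FinDivisor.ndeg K (Y.thetaPilot i) = FinDivisor.ndeg F (X.thetaPilot i') := by
  rw [← ndeg_ofFinDivisor, ← ndeg_ofFinDivisor, ofFinDivisor_thetaPilot_eq_pullback X Y hS hord hl i i' hii',
    ndeg_pullback]

/-- **`deĝ̲_lgp(P_Θ(Y)) = deĝ̲_lgp(P_Θ(X))`**: the normalised lgp-degree of the theta pilot (Dupuy–Hilado Def.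
3.1.1, `(1/ℓ⋇)·Σ_j deĝ̲(P_{Θ,j})`) does not depend on the field carrying the pilot data.
[cite: DupuyHilado2025, Def. 3.1.1, §2.5.4, §3.3] -/
theorem ndegLgp_thetaPilot_eq (hl : Y.l = X.l) :
    LgpDivisor.ndegLgp Y.thetaPilot = LgpDivisor.ndegLgp X.thetaPilot := by
  have hls : Y.lstar = X.lstar := lstar_eq_of_l_eq X Y hl
  have hsum : ∑ j : Fin Y.lstar, FinDivisor.ndeg K (Y.thetaPilot j) =
      ∑ j : Fin X.lstar, FinDivisor.ndeg F (X.thetaPilot j) :=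
    Fintype.sum_equiv (finCongr hls) _ _ fun i =>
      ndeg_thetaPilot_eq X Y hS hord hl i (finCongr hls i) (by simp)
  unfold LgpDivisor.ndegLgp
  rw [hsum, hls]

end Compare

/-! ## §5. The `j`-invariant form: `Y.jE = j_E` viewed in `K` -/

section SameJ

variable (X : PilotData F) (Y : PilotData K)
  (hS : ∀ w : HeightOneSpectrum (𝓞 K), w ∈ Y.S ↔ finBelow F K w ∈ X.S)
  (hj : Y.jE = algebraMap F K X.jE) (hl : Y.l = X.l)

include hS hj

/-- `P_q(Y) = P_q(X)|_K` for the `K`-level datum with the same `j`-invariant and `S_K` over `S`.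
[cite: Mochizuki2012, IUTchIV Def. 1.9 (i) p. 22] [cite: DupuyHilado2025, §3.3] -/
theorem ofFinDivisor_qPilot_eq_pullback_of_jE_eq (hl : Y.l = X.l) :
    ADivisor.ofFinDivisor K Y.qPilot = (ADivisor.ofFinDivisor F X.qPilot).pullback F K :=
  ofFinDivisor_qPilot_eq_pullback X Y hS (fun w _ => ordq_eq_of_jE_eq X Y hj w) hl

/-- **`deĝ̲_K(P_q(Y)) = deĝ̲_F(P_q(X))`** for the `K`-level datum with the same `j`-invariant and `S_K` over `S` —
the form consumed by the `K`-level provenance of the pilot data of an initial Θ-datum (`K = F(E_F[l])`).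
[cite: Mochizuki2012, IUTchIV Thm. 1.10 p. 23] [cite: DupuyHilado2025, §2.5.4, §3.3] -/
theorem ndeg_qPilot_eq_of_jE_eq (hl : Y.l = X.l) : FinDivisor.ndeg K Y.qPilot = FinDivisor.ndeg F X.qPilot :=
  ndeg_qPilot_eq X Y hS (fun w _ => ordq_eq_of_jE_eq X Y hj w) hl

/-- `deĝ̲_K(𝔮(Y)) = deĝ̲_F(𝔮(X))` for the `K`-level datum with the same `j`-invariant and `S_K` over `S`.
[cite: Mochizuki2012, IUTchIV Thm. 1.10 p. 23] [cite: DupuyHilado2025, §2.5.4, §3.3] -/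
theorem ndeg_qDivisor_eq_of_jE_eq : FinDivisor.ndeg K Y.qDivisor = FinDivisor.ndeg F X.qDivisor :=
  ndeg_qDivisor_eq X Y hS (fun w _ => ordq_eq_of_jE_eq X Y hj w)

/-- `deĝ̲_lgp(P_Θ(Y)) = deĝ̲_lgp(P_Θ(X))` for the `K`-level datum with the same `j`-invariant and `S_K` over `S`.
[cite: DupuyHilado2025, Def. 3.1.1, §2.5.4, §3.3] -/
theorem ndegLgp_thetaPilot_eq_of_jE_eq (hl : Y.l = X.l) :
    LgpDivisor.ndegLgp Y.thetaPilot = LgpDivisor.ndegLgp X.thetaPilot :=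
  ndegLgp_thetaPilot_eq X Y hS (fun w _ => ordq_eq_of_jE_eq X Y hj w) hl

end SameJ

end PilotData

end Literature.IUT.LogVolume

end
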